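import Summits.ResolutionOfSingularities.ResolutionOfSingularities.Theorems.HilbertSamuelEliminationSigmaMaxModificationsCorridor3SigmaRowRunPFrameGood
import Summits.ResolutionOfSingularities.ResolutionOfSingularities.Theorems.HilbertSamuelEliminationSigmaMaxModificationsCorridor3SigmaRowRunPFrameLaws
import HarnessLib

/-!
# [OURS · L1 W4.2] ENGINE-I «ROW-P» — THE INSTANCE, FILE A″: the ENGINE'S OWN SCOPE `RowEngine.regularTopScope` — «the stage is regular and the row is the top
# row» is CLOSED under P-steps (a non-vacuity witness for the scope socket of `RowRunFrame.ofRowGood`)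
# (cell res-hironaka, LADDER-RESOLUTION rung L; slot W4.2, crux chain w42 `SigmaMaxModificationsCorridor3` stmt-ResolutionOfSingularities-19249 / crux
# stmt-…-18506; RULING v3.14-51a (51a-F); res-L1-w42-tri-2 (B-1)/(g1) «`Good` non-vacuity»; seat res-D-pv-060 g9; `--supports stmt-…-19249 --as helper`, counted 0)

HONEST FRAMING. OURS bookkeeping over FILE A/A′/C (`RowEngine.Scope`, `isRegular_next`, `isTop_next`). Nothing here is a statement of H. Hironaka's manuscript
[Hironaka2017] (CANDIDATE, never a premise) nor of [Cutkosky2009]. One `def`, every `theorem` PROVED. AI-written, weaker than expert review.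

WHAT. The scope socket `sc : eng.Scope` of the scoped frame asks for a predicate CLOSED under the engine's step. This file builds the part of the intended scope the
engine preserves BY ITSELF: `Good s := Scheme.IsRegular s.W ∧ s.IsTop S₀` — regular stage ([CoP1]: blow-up of a regular scheme in a regular centre, socket
`γ_regular`) and TOP-ROW ENTRY (B1)(v) (the controlled transform at `S₀` along the P-centre does not raise the order of `N`, `isTop_next`). The remaining intended
contents (snc of the boundary with the P-centres / `Nodup` of the old epoch — what `η ≤ 3` on `T` needs, tri-2 (g1)) are for FILE D2.

* `RowEngine.regularTopScope eng : eng.Scope` — `Good := IsRegular W ∧ IsTop`, `good_next` PROVED.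
* `RowEngine.mem_regularTopScope_iff` — unfolding.

References: Cossart–Piltant 2008 [CoP1] Prop. 4.2 (a) via the tree's `RegularCentreBlowupOrder`; Cutkosky 2009 Def. 5.5 [Cutkosky2009] (shape only).
-/

set_option linter.dupNamespace false -- mandated namespace of this single-conjunct summit

noncomputable section

open CategoryTheory AlgebraicGeometry TopologicalSpace
open Literature.AlgebraicGeometry.Resolution

namespace Summit.ResolutionOfSingularities.ResolutionOfSingularities.Theorems.SigmaMaxModificationsCorridor3.RowRunP

universe u

namespace RowEngine

variable {m S₀ : ℕ} (eng : RowEngine.{u} m S₀)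

/-- [OURS · L1 W4.2] **THE ENGINE'S OWN SCOPE**: regular stage and top-row entry, closed under P-steps (`isRegular_next`, `isTop_next`). A non-vacuity witness for the
scope socket of `RowRunFrame.ofRowGood` (the snc / no-repeat part of the intended scope is FILE D2's). [folklore] -/
def regularTopScope : eng.Scope where
  Good s := Scheme.IsRegular s.W ∧ s.IsTop S₀
  good_next _ hs hT := ⟨eng.isRegular_next hs.1 hT, eng.isTop_next hs.1 hs.2 hT⟩

/-- Unfolding the engine's own scope. [folklore] -/
theorem good_regularTopScope_iff (s : RowState.{u}) : eng.regularTopScope.Good s ↔ Scheme.IsRegular s.W ∧ s.IsTop S₀ := Iff.rfl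

/-- Along the scoped instance over the engine's own scope every state has a regular stage. PROVED. [folklore] -/
theorem isRegular_of_regularTopScope (s : (RowRunFrame.ofRowGood m S₀ eng eng.regularTopScope).St) : Scheme.IsRegular s.1.W := s.2.1

/-- … and is a top-row state ((B1)(v)). PROVED. [folklore] -/
theorem isTop_of_regularTopScope (s : (RowRunFrame.ofRowGood m S₀ eng eng.regularTopScope).St) : s.1.IsTop S₀ := s.2.2

end RowEngine

end Summit.ResolutionOfSingularities.ResolutionOfSingularities.Theorems.SigmaMaxModificationsCorridor3.RowRunP

end
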